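import Mathlib
import Summits.CriticalPhenomena.PercolationContinuityZ3.Theorems.PercNearOneGluingNoHeavyLowerTailLogDerivSchema

/-!
# `NoHeavyLowerTail` (stmt-CriticalPhenomena-4575) — Sahi's `E₃` along one coordinate: Bernstein coefficients,
# the two-level ("C₃-M⁻") endpoint form, and the covariance form of `E₃`

Support file (new-inequality factory seat `prim-ineq-gen-4` gen 5; `--supports stmt-CriticalPhenomena-4575`).  Pure `ring`
identities over a commutative ring plus one application of `LogDerivSchema.bernstein_logDeriv_at_zero`; no definitions,
no named facts, no sorries.  Companion of `…LogDerivSchema` (p195570) and of the memo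
run/shared/lean/prim/prim-ineq-gen-4/FINDING-PRODUCT-FORM-SAHI-g5.md §II, §V.

SETTING.  Sahi's third functional of three functions under a probability measure, written in the seven moments
`e = E[fgh]`, `aᵢ = E[fᵢ]`, `b₁ = E[gh]`, `b₂ = E[fh]`, `b₃ = E[fg]`:
`E₃ = 2e − (a₁b₁ + a₂b₂ + a₃b₃) + a₁a₂a₃`  (tree: `Literature.Probability.LatticeModels.sahiE3` / `ThreeCopy.e3h`).
Along one coordinate of weight `p` of a product space every moment is affine in `p` between its two SECTION values
(level `0`: the coordinate is `0` in the argument of `f,g,h`; level `1`): `e(p) = (1−p)e⁰ + p e¹`, `aᵢ(p) = (1−p)aᵢ⁰ + p aᵢ¹`,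
`bᵢ(p) = (1−p)bᵢ⁰ + p bᵢ¹`.  Hence `p ↦ E₃(p)` is a cubic; this file records
* `sahiE3_bernstein` — its Bernstein form `β₀(1−p)³ + 3β₁p(1−p)² + 3β₂p²(1−p) + β₃p³` with
  `β₀ = E₃⁰`, `β₃ = E₃¹`, `3β₁ = 4e⁰ + 2e¹ − Σᵢ(aᵢ⁰bᵢ⁰ + aᵢ⁰bᵢ¹ + aᵢ¹bᵢ⁰) + (a₁¹a₂⁰a₃⁰ + a₁⁰a₂¹a₃⁰ + a₁⁰a₂⁰a₃¹)`,
  `3β₂` = the same with levels `0 ↔ 1`;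
* `sahiE3_M_minus_form` — the endpoint quantity of the log-derivative schema,
  `3β₁ − β₀ = 2e⁰ + 2e¹ − Σᵢ(aᵢ⁰bᵢ¹ + aᵢ¹bᵢ⁰) + (a₁¹a₂⁰a₃⁰ + a₁⁰a₂¹a₃⁰ + a₁⁰a₂⁰a₃¹) − a₁⁰a₂⁰a₃⁰`
  ("C₃-M⁻", memo §II: by `LogDerivSchema.nonneg_of_logDeriv_nonneg` + `logDeriv_reparam`, nonnegativity of this two-level
  expression for all nested sextuples of up-sets implies Sahi's conjecture `E₃ ≥ 0` for every product measure on a finite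
  Boolean lattice; census: 0 violations on 5·10⁴ random sextuples, and its coefficientwise refinement COMB-M⁻ has 0 violations
  on all 804 440 up-set triples of `{0,1}⁴`), together with `sahiE3_M_plus_form`: `3β₂ − β₃ = (3β₁ − β₀) − δ₁δ₂δ₃`
  (`δᵢ = aᵢ¹ − aᵢ⁰`), so for increasing data (`δᵢ ≥ 0`) M⁺ is the (slightly) stronger side;
* `sahiE3_logDeriv_at_zero` — `2·E₃(0) + E₃′(0) = 3β₁ − β₀` for the cubic (from `LogDerivSchema.bernstein_logDeriv_at_zero`);
* `sahiE3_cov_form` — the covariance form `E₃ = 2·Cov(h,fg) + a₃·Cov(f,g) − a₁·Cov(g,h) − a₂·Cov(f,h)` (moments: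
  `Cov(h,fg) = e − a₃b₃`, `Cov(f,g) = b₃ − a₁a₂`, …), and `sahiE3_single_function`: if only `f` depends on the coordinate
  (`g,h` level-independent) the cubic is affine and `3β₁ − β₀ = E₃⁰ + E₃¹`.
[cite: Sahi2008, Conj. 5 and the definition of `E₃`]; [cite: LiebSahi2021, Def. 3.1].
-/

namespace Summit.CriticalPhenomena.PercolationContinuityZ3.Theorems

namespace SahiE3TwoLevel

/-- **Bernstein form of `p ↦ E₃` along one coordinate** (moments affine in `p` between the two section levels). [this file] -/
theorem sahiE3_bernstein {R : Type*} [CommRing R]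
    (e₀ e₁ a₁₀ a₁₁ a₂₀ a₂₁ a₃₀ a₃₁ b₁₀ b₁₁ b₂₀ b₂₁ b₃₀ b₃₁ p : R) :
    let E3 : R → R := fun p =>
      2 * ((1 - p) * e₀ + p * e₁)
        - (((1 - p) * a₁₀ + p * a₁₁) * ((1 - p) * b₁₀ + p * b₁₁)
          + ((1 - p) * a₂₀ + p * a₂₁) * ((1 - p) * b₂₀ + p * b₂₁)
          + ((1 - p) * a₃₀ + p * a₃₁) * ((1 - p) * b₃₀ + p * b₃₁))
        + ((1 - p) * a₁₀ + p * a₁₁) * ((1 - p) * a₂₀ + p * a₂₁) * ((1 - p) * a₃₀ + p * a₃₁)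
    let β₀ := 2 * e₀ - (a₁₀ * b₁₀ + a₂₀ * b₂₀ + a₃₀ * b₃₀) + a₁₀ * a₂₀ * a₃₀
    let β₃ := 2 * e₁ - (a₁₁ * b₁₁ + a₂₁ * b₂₁ + a₃₁ * b₃₁) + a₁₁ * a₂₁ * a₃₁
    let β₁ := 4 * e₀ + 2 * e₁
        - ((a₁₀ * b₁₀ + a₁₀ * b₁₁ + a₁₁ * b₁₀) + (a₂₀ * b₂₀ + a₂₀ * b₂₁ + a₂₁ * b₂₀)
            + (a₃₀ * b₃₀ + a₃₀ * b₃₁ + a₃₁ * b₃₀))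
        + (a₁₁ * a₂₀ * a₃₀ + a₁₀ * a₂₁ * a₃₀ + a₁₀ * a₂₀ * a₃₁)
    let β₂ := 4 * e₁ + 2 * e₀
        - ((a₁₁ * b₁₁ + a₁₁ * b₁₀ + a₁₀ * b₁₁) + (a₂₁ * b₂₁ + a₂₁ * b₂₀ + a₂₀ * b₂₁)
            + (a₃₁ * b₃₁ + a₃₁ * b₃₀ + a₃₀ * b₃₁))
        + (a₁₀ * a₂₁ * a₃₁ + a₁₁ * a₂₀ * a₃₁ + a₁₁ * a₂₁ * a₃₀)
    3 * E3 p = 3 * β₀ * (1 - p) ^ 3 + 3 * β₁ * p * (1 - p) ^ 2 + 3 * β₂ * p ^ 2 * (1 - p)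
      + 3 * β₃ * p ^ 3 := by
  intro E3 β₀ β₃ β₁ β₂
  simp only [E3, β₀, β₁, β₂, β₃]
  ring

/-- **The two-level endpoint form (C₃-M⁻).**  With `3β₁` and `β₀` as in `sahiE3_bernstein`,
`3β₁ − β₀ = 2e⁰ + 2e¹ − Σᵢ(aᵢ⁰bᵢ¹ + aᵢ¹bᵢ⁰) + Σ_cyc a¹a⁰a⁰ − a₁⁰a₂⁰a₃⁰`. [this file] -/
theorem sahiE3_M_minus_form {R : Type*} [CommRing R]
    (e₀ e₁ a₁₀ a₁₁ a₂₀ a₂₁ a₃₀ a₃₁ b₁₀ b₁₁ b₂₀ b₂₁ b₃₀ b₃₁ : R) :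
    (4 * e₀ + 2 * e₁
        - ((a₁₀ * b₁₀ + a₁₀ * b₁₁ + a₁₁ * b₁₀) + (a₂₀ * b₂₀ + a₂₀ * b₂₁ + a₂₁ * b₂₀)
            + (a₃₀ * b₃₀ + a₃₀ * b₃₁ + a₃₁ * b₃₀))
        + (a₁₁ * a₂₀ * a₃₀ + a₁₀ * a₂₁ * a₃₀ + a₁₀ * a₂₀ * a₃₁))
      - (2 * e₀ - (a₁₀ * b₁₀ + a₂₀ * b₂₀ + a₃₀ * b₃₀) + a₁₀ * a₂₀ * a₃₀)
    = 2 * e₀ + 2 * e₁ - ((a₁₀ * b₁₁ + a₁₁ * b₁₀) + (a₂₀ * b₂₁ + a₂₁ * b₂₀) + (a₃₀ * b₃₁ + a₃₁ * b₃₀))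
      + (a₁₁ * a₂₀ * a₃₀ + a₁₀ * a₂₁ * a₃₀ + a₁₀ * a₂₀ * a₃₁) - a₁₀ * a₂₀ * a₃₀ := by
  ring

/-- **M⁺ versus M⁻:** `3β₂ − β₃ = (3β₁ − β₀) − δ₁δ₂δ₃` with `δᵢ = aᵢ¹ − aᵢ⁰`. [this file] -/
theorem sahiE3_M_plus_form {R : Type*} [CommRing R]
    (e₀ e₁ a₁₀ a₁₁ a₂₀ a₂₁ a₃₀ a₃₁ b₁₀ b₁₁ b₂₀ b₂₁ b₃₀ b₃₁ : R) :
    (4 * e₁ + 2 * e₀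
        - ((a₁₁ * b₁₁ + a₁₁ * b₁₀ + a₁₀ * b₁₁) + (a₂₁ * b₂₁ + a₂₁ * b₂₀ + a₂₀ * b₂₁)
            + (a₃₁ * b₃₁ + a₃₁ * b₃₀ + a₃₀ * b₃₁))
        + (a₁₀ * a₂₁ * a₃₁ + a₁₁ * a₂₀ * a₃₁ + a₁₁ * a₂₁ * a₃₀))
      - (2 * e₁ - (a₁₁ * b₁₁ + a₂₁ * b₂₁ + a₃₁ * b₃₁) + a₁₁ * a₂₁ * a₃₁)
    = (2 * e₀ + 2 * e₁ - ((a₁₀ * b₁₁ + a₁₁ * b₁₀) + (a₂₀ * b₂₁ + a₂₁ * b₂₀) + (a₃₀ * b₃₁ + a₃₁ * b₃₀))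
        + (a₁₁ * a₂₀ * a₃₀ + a₁₀ * a₂₁ * a₃₀ + a₁₀ * a₂₀ * a₃₁) - a₁₀ * a₂₀ * a₃₀)
      - (a₁₁ - a₁₀) * (a₂₁ - a₂₀) * (a₃₁ - a₃₀) := by
  ring

/-- **Log-derivative endpoint for `E₃`:** for the cubic `p ↦ E₃(p)` of `sahiE3_bernstein`,
`2·E₃(0) + (1−0)·E₃′(0) = 3β₁ − β₀` (the quantity of `sahiE3_M_minus_form`). [this file] -/
theorem sahiE3_logDeriv_at_zero
    (e₀ e₁ a₁₀ a₁₁ a₂₀ a₂₁ a₃₀ a₃₁ b₁₀ b₁₁ b₂₀ b₂₁ b₃₀ b₃₁ : ℝ) :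
    let E3 : ℝ → ℝ := fun p =>
      2 * ((1 - p) * e₀ + p * e₁)
        - (((1 - p) * a₁₀ + p * a₁₁) * ((1 - p) * b₁₀ + p * b₁₁)
          + ((1 - p) * a₂₀ + p * a₂₁) * ((1 - p) * b₂₀ + p * b₂₁)
          + ((1 - p) * a₃₀ + p * a₃₁) * ((1 - p) * b₃₀ + p * b₃₁))
        + ((1 - p) * a₁₀ + p * a₁₁) * ((1 - p) * a₂₀ + p * a₂₁) * ((1 - p) * a₃₀ + p * a₃₁)
    2 * E3 0 + (1 - 0) * deriv E3 0
      = 2 * e₀ + 2 * e₁ - ((a₁₀ * b₁₁ + a₁₁ * b₁₀) + (a₂₀ * b₂₁ + a₂₁ * b₂₀) + (a₃₀ * b₃₁ + a₃₁ * b₃₀))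
        + (a₁₁ * a₂₀ * a₃₀ + a₁₀ * a₂₁ * a₃₀ + a₁₀ * a₂₀ * a₃₁) - a₁₀ * a₂₀ * a₃₀ := by
  intro E3
  set β₀ := 2 * e₀ - (a₁₀ * b₁₀ + a₂₀ * b₂₀ + a₃₀ * b₃₀) + a₁₀ * a₂₀ * a₃₀ with hβ₀
  set β₃ := 2 * e₁ - (a₁₁ * b₁₁ + a₂₁ * b₂₁ + a₃₁ * b₃₁) + a₁₁ * a₂₁ * a₃₁ with hβ₃
  set β₁ := (4 * e₀ + 2 * e₁
        - ((a₁₀ * b₁₀ + a₁₀ * b₁₁ + a₁₁ * b₁₀) + (a₂₀ * b₂₀ + a₂₀ * b₂₁ + a₂₁ * b₂₀)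
            + (a₃₀ * b₃₀ + a₃₀ * b₃₁ + a₃₁ * b₃₀))
        + (a₁₁ * a₂₀ * a₃₀ + a₁₀ * a₂₁ * a₃₀ + a₁₀ * a₂₀ * a₃₁)) / 3 with hβ₁
  set β₂ := (4 * e₁ + 2 * e₀
        - ((a₁₁ * b₁₁ + a₁₁ * b₁₀ + a₁₀ * b₁₁) + (a₂₁ * b₂₁ + a₂₁ * b₂₀ + a₂₀ * b₂₁)
            + (a₃₁ * b₃₁ + a₃₁ * b₃₀ + a₃₀ * b₃₁))
        + (a₁₀ * a₂₁ * a₃₁ + a₁₁ * a₂₀ * a₃₁ + a₁₁ * a₂₁ * a₃₀)) / 3 with hβ₂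
  have hfun : E3 = fun p : ℝ => β₀ * (1 - p) ^ 3 + 3 * β₁ * p * (1 - p) ^ 2
      + 3 * β₂ * p ^ 2 * (1 - p) + β₃ * p ^ 3 := by
    funext p
    simp only [E3, hβ₀, hβ₁, hβ₂, hβ₃]
    ring
  rw [hfun, LogDerivSchema.bernstein_logDeriv_at_zero β₀ β₁ β₂ β₃]
  simp only [hβ₁, hβ₀]
  ring

/-- **Covariance form of Sahi's `E₃`:** `E₃ = 2·Cov(h,fg) + E h·Cov(f,g) − E f·Cov(g,h) − E g·Cov(f,h)` in moments
(`e = E[fgh]`, `aᵢ = E fᵢ`, `b₁ = E[gh]`, `b₂ = E[fh]`, `b₃ = E[fg]`). [this file] -/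
theorem sahiE3_cov_form {R : Type*} [CommRing R] (e a₁ a₂ a₃ b₁ b₂ b₃ : R) :
    2 * e - (a₁ * b₁ + a₂ * b₂ + a₃ * b₃) + a₁ * a₂ * a₃
      = 2 * (e - a₃ * b₃) + a₃ * (b₃ - a₁ * a₂) - a₁ * (b₁ - a₂ * a₃) - a₂ * (b₂ - a₁ * a₃) := by
  ring

/-- **Single-function dependence is trivial:** if `g, h` do not depend on the coordinate (`a₂,a₃,b₁` level-independent,
and consequently `b₂, b₃, e` affine through `f` only: `b₂^ε = E[f^ε h]`, `b₃^ε = E[f^ε g]`, `e^ε = E[f^ε gh]`), then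
`3β₁ − β₀ = E₃⁰ + E₃¹`. [this file] -/
theorem sahiE3_single_function {R : Type*} [CommRing R] (e₀ e₁ a₁₀ a₁₁ a₂ a₃ b₁ b₂₀ b₂₁ b₃₀ b₃₁ : R) :
    2 * e₀ + 2 * e₁ - ((a₁₀ * b₁ + a₁₁ * b₁) + (a₂ * b₂₁ + a₂ * b₂₀) + (a₃ * b₃₁ + a₃ * b₃₀))
        + (a₁₁ * a₂ * a₃ + a₁₀ * a₂ * a₃ + a₁₀ * a₂ * a₃) - a₁₀ * a₂ * a₃
      = (2 * e₀ - (a₁₀ * b₁ + a₂ * b₂₀ + a₃ * b₃₀) + a₁₀ * a₂ * a₃)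
        + (2 * e₁ - (a₁₁ * b₁ + a₂ * b₂₁ + a₃ * b₃₁) + a₁₁ * a₂ * a₃) := by
  ring

end SahiE3TwoLevel

end Summit.CriticalPhenomena.PercolationContinuityZ3.Theorems
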